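import Summits.Schanuel.Schanuel.Theorems.RootDecomp1KHyper05

/-!
# RootDecomp1KHyper — part 6 of the «HyperCarving» port wave (lens 6, gen 9 = ROUND 4 of route-Schanuel-RootDecomp1K; 19 parts planned)

Mechanical port (census-1 gen 7, dependency closure; tools census/tools/gen7/portkit2.py + build_l6g9.py) of §17 of HOME/decomp-schanuel-lens-6/g9/HyperCarving.lean
(sha256 aba5c91f…, 8041 l; critic CLEARED FOR TYPING 2026-08-30T13:33:07Z; writer PATH A″ rev 5–8) together with the §§0–16 declarations it depends on
(nothing of the node was in the tree before except RootDecomp1KLinLiouvilleSplit and the Literature fact NesterenkoWaldschmidt1996_thm_5_1).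
This part: node lines 3762–4071 (28 declarations: HyperLiouville.liouville, HyperLiouville.irrational, C₀rat, ExplicitRatExpApprox, hcoef, hpoly …).
All parts share the namespace `Summit.Schanuel.Schanuel.Theorems.RootDecomp1KHyper` (node sub-namespace `HyperCell` reproduced); statements and proofs
are the node's verbatim; `--supports stmt-Schanuel-33363` (A₄ʰ HyperLiouvilleSchanuel). Sorry-free; standard axioms. Nothing here proves Schanuel; rung 0.
-/

set_option linter.dupNamespace false
set_option linter.unusedSectionVars false

noncomputable section

open Complex IntermediateField Filter Polynomial

namespace Summit.Schanuel.Schanuel.Theorems.RootDecomp1KHyper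

variable {n K : ℕ}

/-- `log log 16 > 1` (copy of the tree's
`…HeightWindowCompactness.ExpFiniteTypeOfWaldschmidt.one_lt_log_log_sixteen`). -/
private theorem one_lt_log_log_sixteen : (1 : ℝ) < Real.log (Real.log 16) := by
  have h2 : (0.6931471803 : ℝ) < Real.log 2 := Real.log_two_gt_d9
  have h16 : Real.log 16 = 4 * Real.log 2 := by
    rw [show (16 : ℝ) = 2 ^ 4 by norm_num, Real.log_pow]; norm_num
  have he : Real.exp 1 < Real.log 16 := by
    rw [h16]; have := Real.exp_one_lt_d9; linarith
  rwa [Real.lt_log_iff_exp_lt (by rw [h16]; linarith)]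

namespace HyperCell

variable {n K : ℕ}

/-- §16. An e^ℓ-LOAD-BEARING decided cell: (ρ, e^ρ) algebraically independent for: auxiliary statement `HyperLiouville.liouville` (lens 6 gen 9 node, ported verbatim). -/
theorem HyperLiouville.liouville {ρ : ℝ} (h : HyperLiouville ρ) : Liouville ρ := by
  intro n
  obtain ⟨r, hden, hne, hlt⟩ := h (n + 2)
  have hd2 : 2 ≤ r.den := le_trans (by omega) hden
  have hd1 : (1 : ℝ) ≤ r.den := by exact_mod_cast r.den_pos
  have hr : (r : ℝ) = (r.num : ℝ) / ((r.den : ℤ) : ℝ) := by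
    rw [Int.cast_natCast]; exact Rat.cast_def r
  refine ⟨r.num, r.den, by exact_mod_cast hd2, hr ▸ hne, ?_⟩
  rw [← hr]
  refine hlt.trans_le ?_
  rw [Real.exp_neg, Int.cast_natCast, ← one_div]
  exact one_div_le_one_div_of_le (by positivity) (pow_le_exp_pow hd1 (by omega))

/-- §16. An e^ℓ-LOAD-BEARING decided cell: (ρ, e^ρ) algebraically independent for: auxiliary statement `HyperLiouville.irrational` (lens 6 gen 9 node, ported verbatim). -/
theorem HyperLiouville.irrational {ρ : ℝ} (h : HyperLiouville ρ) : Irrational ρ :=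
  h.liouville.irrational

/-- The constant of the tree's `Waldschmidt1978.approx_measure_exp_alg`
(`Literature/…/ExpAlgebraicTranscendenceMeasureProofs.lean`, W78 Thm 3.8 / NW96 Thm 1 made
explicit) at a RATIONAL exponent `β = r`: there `C₀ = 1.28·10⁹ · g · d_β² · (1 + log d_β + (20 + g + C_h))²`
with `d_β = [ℚ(β):ℚ] = 1`, `g = d_β + ⌈‖β‖⌉₊ + 1 = ⌈|r|⌉₊ + 2` and `C_h = h(r) = log max(|num r|, den r)`
(an admissible height bound by `RoyWaldschmidt1997.MahlerWeil.weilHeight₁_root_le` with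
`P = den·X − num`). -/
def C₀rat (r : ℚ) : ℝ :=
  1280000000 * ((⌈|(r : ℝ)|⌉₊ : ℝ) + 2) *
    (1 + (20 + ((⌈|(r : ℝ)|⌉₊ : ℝ) + 2) + Real.log (max (|(r.num : ℝ)|) (r.den : ℝ)))) ^ 2

/-- **Support hypothesis `hX` (explicit rational-exponent approximation measure for `exp`).**
For `r ∈ ℚ∖{0}` and `ξ` a root of an irreducible `Q ∈ ℤ[X]` of degree `n ≥ 1` with
`log M(Q) ≤ Y`, `Y ≥ log 16`:
`‖e^r − ξ‖ ≥ exp(−C₀(r) · n² · Y · (log Y + log n)² / (log Y)²)`.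
This is VERBATIM the conclusion of the tree's theorem `Waldschmidt1978.approx_measure_exp_alg`
at `β = r` with its constant instantiated (`C₀rat`); it is a PROVABLE support statement (the
module `ExpAlgebraicTranscendenceMeasureProofs` is in the tree but unbuilt on the farm tonight,
so it is carried as a hypothesis, exactly like `NWMeasure`/`WMeasure` in §§6–8). -/
def ExplicitRatExpApprox : Prop :=
  ∀ r : ℚ, r ≠ 0 → ∀ Q : ℤ[X], Irreducible Q → 0 < Q.natDegree → ∀ ξ : ℂ, aeval ξ Q = 0 →
    ∀ Y : ℝ, Real.log 16 ≤ Y → Real.log (Q.map (Int.castRingHom ℂ)).mahlerMeasure ≤ Y →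
      Real.exp (-(C₀rat r * (Q.natDegree : ℝ) ^ 2 * Y *
        (Real.log Y + Real.log Q.natDegree) ^ 2 / Real.log Y ^ 2)) ≤ ‖cexp (r : ℂ) - ξ‖

/-- `a_k(p,q) = q^D · G_k(p/q) = Σ_i g_{k,i} p^i q^{D−i} ∈ ℤ`. -/
def hcoef (G : Fin (K + 1) → ℤ[X]) (D : ℕ) (p : ℤ) (q : ℕ) (k : Fin (K + 1)) : ℤ :=
  ∑ i ∈ Finset.range (D + 1), (G k).coeff i * p ^ i * (q : ℤ) ^ (D - i)

/-- `A_{p/q}(Y) = Σ_k a_k(p,q) Y^k ∈ ℤ[Y]`. -/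
def hpoly (G : Fin (K + 1) → ℤ[X]) (D : ℕ) (p : ℤ) (q : ℕ) : ℤ[X] :=
  ∑ k : Fin (K + 1), C (hcoef G D p q k) * X ^ (k : ℕ)

/-- §16a. Homogenised specialisation X := p/q of an integer relation: auxiliary statement `hcoef_cast` (lens 6 gen 9 node, ported verbatim). -/
theorem hcoef_cast (G : Fin (K + 1) → ℤ[X]) {D : ℕ} (hD : ∀ k, (G k).natDegree ≤ D) (p : ℤ)
    {q : ℕ} (hq : q ≠ 0) (k : Fin (K + 1)) :
    (hcoef G D p q k : ℂ) = (q : ℂ) ^ D * aeval ((p : ℂ) / q) (G k) := by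
  have hqC : (q : ℂ) ≠ 0 := by exact_mod_cast hq
  rw [Polynomial.aeval_eq_sum_range' (Nat.lt_succ_of_le (hD k)), Finset.mul_sum]
  unfold hcoef
  push_cast
  refine Finset.sum_congr rfl fun i hi => ?_
  have hiD : i ≤ D := Nat.lt_succ_iff.mp (Finset.mem_range.mp hi)
  have hsplit : (q : ℂ) ^ D = (q : ℂ) ^ i * (q : ℂ) ^ (D - i) := by
    rw [← pow_add, Nat.add_sub_cancel' hiD]
  rw [zsmul_eq_mul, hsplit, div_pow]
  field_simp

/-- §16a. Homogenised specialisation X := p/q of an integer relation: auxiliary statement `coeff_hpoly` (lens 6 gen 9 node, ported verbatim). -/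
theorem coeff_hpoly (G : Fin (K + 1) → ℤ[X]) (D : ℕ) (p : ℤ) (q : ℕ) (j : ℕ) :
    (hpoly G D p q).coeff j = if h : j ≤ K then hcoef G D p q ⟨j, Nat.lt_succ_of_le h⟩ else 0 := by
  unfold hpoly
  simp only [finsetSum_coeff, coeff_C_mul, coeff_X_pow]
  split_ifs with h
  · rw [Finset.sum_eq_single ⟨j, Nat.lt_succ_of_le h⟩]
    · simp
    · intro k _ hk
      have : (j : ℕ) ≠ k := fun e => hk (Fin.ext e.symm)
      simp [this]
    · simp
  · refine Finset.sum_eq_zero fun k _ => ?_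
    have : j ≠ (k : ℕ) := fun e => h (e ▸ Nat.lt_succ_iff.mp k.2)
    simp [this]

/-- §16a. Homogenised specialisation X := p/q of an integer relation: auxiliary statement `natDegree_hpoly_le` (lens 6 gen 9 node, ported verbatim). -/
theorem natDegree_hpoly_le (G : Fin (K + 1) → ℤ[X]) (D : ℕ) (p : ℤ) (q : ℕ) :
    (hpoly G D p q).natDegree ≤ K := by
  rw [Polynomial.natDegree_le_iff_coeff_eq_zero]
  intro j hj
  rw [coeff_hpoly, dif_neg]
  exact_mod_cast not_le.mpr hj

/-- §16a. Homogenised specialisation X := p/q of an integer relation: auxiliary statement `coeff_hpoly_fin` (lens 6 gen 9 node, ported verbatim). -/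
theorem coeff_hpoly_fin (G : Fin (K + 1) → ℤ[X]) (D : ℕ) (p : ℤ) (q : ℕ) (k : Fin (K + 1)) :
    (hpoly G D p q).coeff k = hcoef G D p q k := by
  rw [coeff_hpoly, dif_pos (Nat.lt_succ_iff.mp k.2)]

/-- §16a. Homogenised specialisation X := p/q of an integer relation: auxiliary statement `natDegree_hpoly_eq` (lens 6 gen 9 node, ported verbatim). -/
theorem natDegree_hpoly_eq (G : Fin (K + 1) → ℤ[X]) (D : ℕ) (p : ℤ) (q : ℕ)
    (hK : hcoef G D p q (Fin.last K) ≠ 0) : (hpoly G D p q).natDegree = K := by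
  refine Polynomial.natDegree_eq_of_le_of_coeff_ne_zero (natDegree_hpoly_le G D p q) ?_
  have := coeff_hpoly_fin G D p q (Fin.last K)
  rw [Fin.val_last] at this
  rwa [this]

/-- §16a. Homogenised specialisation X := p/q of an integer relation: auxiliary statement `leadingCoeff_hpoly` (lens 6 gen 9 node, ported verbatim). -/
theorem leadingCoeff_hpoly (G : Fin (K + 1) → ℤ[X]) (D : ℕ) (p : ℤ) (q : ℕ)
    (hK : hcoef G D p q (Fin.last K) ≠ 0) :
    (hpoly G D p q).leadingCoeff = hcoef G D p q (Fin.last K) := by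
  rw [Polynomial.leadingCoeff, natDegree_hpoly_eq G D p q hK]
  have := coeff_hpoly_fin G D p q (Fin.last K)
  rwa [Fin.val_last] at this

/-- §16a. Homogenised specialisation X := p/q of an integer relation: auxiliary statement `hpoly_ne_zero` (lens 6 gen 9 node, ported verbatim). -/
theorem hpoly_ne_zero (G : Fin (K + 1) → ℤ[X]) (D : ℕ) (p : ℤ) (q : ℕ)
    (hK : hcoef G D p q (Fin.last K) ≠ 0) : hpoly G D p q ≠ 0 := by
  intro h0
  apply hK
  rw [← leadingCoeff_hpoly G D p q hK, h0, Polynomial.leadingCoeff_zero]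

/-- §16a. Homogenised specialisation X := p/q of an integer relation: auxiliary statement `aeval_hpoly` (lens 6 gen 9 node, ported verbatim). -/
theorem aeval_hpoly (G : Fin (K + 1) → ℤ[X]) (D : ℕ) (p : ℤ) (q : ℕ) (x : ℂ) :
    aeval x (hpoly G D p q) = ∑ k : Fin (K + 1), (hcoef G D p q k : ℂ) * x ^ (k : ℕ) := by
  unfold hpoly
  rw [map_sum]
  refine Finset.sum_congr rfl fun k _ => ?_
  rw [map_mul, aeval_C, map_pow, aeval_X, algebraMap_int_eq, eq_intCast]

/-- `|a_k(p,q)| ≤ (|p| + q)^D · Σ_i |g_{k,i}|`. -/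
theorem abs_hcoef_le (G : Fin (K + 1) → ℤ[X]) (D : ℕ) (p : ℤ) (q : ℕ) (k : Fin (K + 1)) :
    |hcoef G D p q k| ≤ (|p| + q) ^ D * ∑ i ∈ Finset.range (D + 1), |(G k).coeff i| := by
  unfold hcoef
  rw [Finset.mul_sum]
  refine (Finset.abs_sum_le_sum_abs _ _).trans (Finset.sum_le_sum fun i hi => ?_)
  have hiD : i ≤ D := Nat.lt_succ_iff.mp (Finset.mem_range.mp hi)
  rw [abs_mul, abs_mul, abs_pow, abs_pow, Nat.abs_cast, mul_comm ((|p| + q) ^ D)]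
  rw [mul_assoc]
  refine mul_le_mul_of_nonneg_left ?_ (abs_nonneg _)
  calc |p| ^ i * (q : ℤ) ^ (D - i) ≤ (|p| + q) ^ i * (|p| + q) ^ (D - i) := by
        gcongr
        · exact le_add_of_nonneg_right (by positivity)
        · exact le_add_of_nonneg_left (abs_nonneg p)
    _ = (|p| + q) ^ D := by rw [← pow_add, Nat.add_sub_cancel' hiD]

/-- §16b. Roots: a root within ‖A(w)‖^{1/N}, Gauss, Mahler: auxiliary statement `exists_mem_pow_card_le_norm_prod` (lens 6 gen 9 node, ported verbatim). -/
theorem exists_mem_pow_card_le_norm_prod (w : ℂ) (s : Multiset ℂ) (hs : s ≠ 0) :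
    ∃ a ∈ s, ‖w - a‖ ^ Multiset.card s ≤ ‖(s.map fun a => w - a).prod‖ := by
  induction s using Multiset.induction_on with
  | empty => exact absurd rfl hs
  | cons b s ih =>
    by_cases hs0 : s = 0
    · subst hs0
      exact ⟨b, Multiset.mem_cons_self _ _, by simp⟩
    · obtain ⟨a, ha, hle⟩ := ih hs0
      rw [Multiset.card_cons, Multiset.map_cons, Multiset.prod_cons, norm_mul]
      by_cases hab : ‖w - b‖ ≤ ‖w - a‖
      · refine ⟨b, Multiset.mem_cons_self _ _, ?_⟩
        rw [pow_succ']
        refine mul_le_mul_of_nonneg_left ?_ (norm_nonneg _)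
        exact (pow_le_pow_left₀ (norm_nonneg _) hab _).trans hle
      · refine ⟨a, Multiset.mem_cons_of_mem ha, ?_⟩
        rw [pow_succ, mul_comm ‖w - b‖]
        exact mul_le_mul hle (le_of_lt (not_le.mp hab)) (norm_nonneg _) (norm_nonneg _)

/-- **Root within `‖A(w)‖^{1/N}`**: a complex polynomial of degree `N ≥ 1` whose leading
coefficient has norm `≥ 1` has a root `ξ` with `‖w − ξ‖^N ≤ ‖A(w)‖`. -/
theorem exists_root_pow_le_norm_eval (A : ℂ[X]) (hlead : 1 ≤ ‖A.leadingCoeff‖)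
    (hdeg : 0 < A.natDegree) (w : ℂ) :
    ∃ ξ : ℂ, A.IsRoot ξ ∧ ‖w - ξ‖ ^ A.natDegree ≤ ‖A.eval w‖ := by
  have hcard : Multiset.card A.roots = A.natDegree := splits_iff_card_roots.mp (IsAlgClosed.splits A)
  have hprod := C_leadingCoeff_mul_prod_multiset_X_sub_C hcard
  have hA0 : A ≠ 0 := by rintro rfl; simp at hdeg
  have hs : A.roots ≠ 0 := by
    intro h0; rw [h0, Multiset.card_zero] at hcard; omega
  obtain ⟨ξ, hξ, hle⟩ := exists_mem_pow_card_le_norm_prod w A.roots hs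
  refine ⟨ξ, (Polynomial.mem_roots hA0).mp hξ, ?_⟩
  rw [hcard] at hle
  have hev : A.eval w = A.leadingCoeff * (A.roots.map fun a => w - a).prod := by
    conv_lhs => rw [← hprod]
    rw [eval_mul, eval_C, eval_multiset_prod, Multiset.map_map]
    congr 1
    congr 1
    refine Multiset.map_congr rfl fun a _ => ?_
    simp
  rw [hev, norm_mul]
  calc ‖w - ξ‖ ^ A.natDegree ≤ ‖(A.roots.map fun a => w - a).prod‖ := hle
    _ = 1 * ‖(A.roots.map fun a => w - a).prod‖ := (one_mul _).symm
    _ ≤ ‖A.leadingCoeff‖ * ‖(A.roots.map fun a => w - a).prod‖ := by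
        gcongr

/-- **Gauss**: an irreducible `Q ∈ ℤ[X]` of positive degree sharing a root with `A ∈ ℤ[X]`
divides `A` in `ℤ[X]`. -/
theorem dvd_of_irreducible_of_common_root {Q A : ℤ[X]} (hQ : Irreducible Q)
    (hQd : 0 < Q.natDegree) {ξ : ℂ} (hQξ : aeval ξ Q = 0) (hAξ : aeval ξ A = 0) : Q ∣ A := by
  have hprim : Q.IsPrimitive := hQ.isPrimitive (by omega)
  rw [IsPrimitive.Int.dvd_iff_map_cast_dvd_map_cast Q A hprim]
  have hirr : Irreducible (Q.map (Int.castRingHom ℚ)) :=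
    (IsPrimitive.Int.irreducible_iff_irreducible_map_cast hprim).mp hQ
  have hQξ' : aeval ξ (Q.map (Int.castRingHom ℚ)) = 0 := by
    rw [show Int.castRingHom ℚ = algebraMap ℤ ℚ from rfl, Polynomial.aeval_map_algebraMap]; exact hQξ
  have hAξ' : aeval ξ (A.map (Int.castRingHom ℚ)) = 0 := by
    rw [show Int.castRingHom ℚ = algebraMap ℤ ℚ from rfl, Polynomial.aeval_map_algebraMap]; exact hAξ
  have hmin : minpoly ℚ ξ ∣ A.map (Int.castRingHom ℚ) := minpoly.dvd ℚ ξ hAξ'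
  have heq := minpoly.eq_of_irreducible hirr hQξ'
  obtain ⟨T, hT⟩ := hmin
  refine ⟨C (Q.map (Int.castRingHom ℚ)).leadingCoeff⁻¹ * T, ?_⟩
  rw [← mul_assoc, heq, hT]

/-- §16b. Roots: a root within ‖A(w)‖^{1/N}, Gauss, Mahler: auxiliary statement `one_le_mahlerMeasure_map_of_ne_zero` (lens 6 gen 9 node, ported verbatim). -/
private theorem one_le_mahlerMeasure_map_of_ne_zero {R : ℤ[X]} (hR : R ≠ 0) :
    1 ≤ (R.map (Int.castRingHom ℂ)).mahlerMeasure := by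
  refine one_le_mahlerMeasure_of_one_le_norm_leadingCoeff ?_
  rw [Polynomial.leadingCoeff_map_of_injective (RingHom.injective_int _), eq_intCast,
    Complex.norm_intCast]
  exact_mod_cast Int.one_le_abs (Polynomial.leadingCoeff_ne_zero.mpr hR)

/-- §16b. Roots: a root within ‖A(w)‖^{1/N}, Gauss, Mahler: auxiliary statement `mahlerMeasure_le_of_dvd` (lens 6 gen 9 node, ported verbatim). -/
private theorem mahlerMeasure_le_of_dvd {Q A : ℤ[X]} (hdvd : Q ∣ A) (hA : A ≠ 0) :
    (Q.map (Int.castRingHom ℂ)).mahlerMeasure ≤ (A.map (Int.castRingHom ℂ)).mahlerMeasure := by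
  obtain ⟨R, rfl⟩ := hdvd
  have hR : R ≠ 0 := right_ne_zero_of_mul hA
  rw [Polynomial.map_mul, mahlerMeasure_mul]
  calc (Q.map (Int.castRingHom ℂ)).mahlerMeasure = (Q.map (Int.castRingHom ℂ)).mahlerMeasure * 1 :=
        (mul_one _).symm
    _ ≤ _ := mul_le_mul_of_nonneg_left (one_le_mahlerMeasure_map_of_ne_zero hR)
        (mahlerMeasure_nonneg _)

/-- `M(A) ≤ Σ_{j ≤ N} ‖a_j‖` for any `N ≥ natDegree A`. -/
theorem mahlerMeasure_map_le_sum {A : ℤ[X]} {N : ℕ} (hN : A.natDegree ≤ N) :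
    (A.map (Int.castRingHom ℂ)).mahlerMeasure ≤ ∑ j ∈ Finset.range (N + 1), (|A.coeff j| : ℝ) := by
  refine (mahlerMeasure_le_sum_norm_coeff _).trans ?_
  rw [Polynomial.sum_def]
  have hsub : (A.map (Int.castRingHom ℂ)).support ⊆ Finset.range (N + 1) := by
    refine (Polynomial.supp_subset_range (Nat.lt_succ_of_le ?_))
    exact (Polynomial.natDegree_map_le).trans hN
  refine (Finset.sum_le_sum_of_subset_of_nonneg hsub fun _ _ _ => norm_nonneg _).trans ?_
  refine Finset.sum_le_sum fun j _ => ?_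
  rw [Polynomial.coeff_map, eq_intCast, Complex.norm_intCast]

/-- §16c. Numerical lemmas: auxiliary statement `log_sixteen_lt_three` (lens 6 gen 9 node, ported verbatim). -/
theorem log_sixteen_lt_three : Real.log 16 < 3 := by
  have h2 : Real.log 16 = 4 * Real.log 2 := by
    rw [show (16 : ℝ) = 2 ^ 4 by norm_num, Real.log_pow]; norm_num
  rw [h2]; linarith [Real.log_two_lt_d9]

/-- §16c. Numerical lemmas: auxiliary statement `one_lt_log_log_sixteen` (lens 6 gen 9 node, ported verbatim). -/
private theorem one_lt_log_log_sixteen : 1 < Real.log (Real.log 16) := by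
  have h2 : Real.log 16 = 4 * Real.log 2 := by
    rw [show (16 : ℝ) = 2 ^ 4 by norm_num, Real.log_pow]; norm_num
  have h : Real.exp 1 < Real.log 16 := by
    rw [h2]; linarith [Real.log_two_gt_d9, Real.exp_one_lt_d9]
  calc (1 : ℝ) = Real.log (Real.exp 1) := (Real.log_exp 1).symm
    _ < Real.log (Real.log 16) := Real.log_lt_log (Real.exp_pos 1) h

/-- §16c. Numerical lemmas: auxiliary statement `one_lt_log_of_log_sixteen_le` (lens 6 gen 9 node, ported verbatim). -/
theorem one_lt_log_of_log_sixteen_le {Y : ℝ} (hY : Real.log 16 ≤ Y) : 1 < Real.log Y :=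
  one_lt_log_log_sixteen.trans_le (Real.log_le_log (Real.log_pos (by norm_num)) hY)

/-- §16c. Numerical lemmas: auxiliary statement `log_le_self_of_nonneg` (lens 6 gen 9 node, ported verbatim). -/
private theorem log_le_self_of_nonneg {x : ℝ} (h0 : 0 ≤ x) : Real.log x ≤ x := by
  rcases eq_or_lt_of_le h0 with h | h
  · rw [← h, Real.log_zero]
  · linarith [Real.log_le_sub_one_of_pos h]

/-- `x · e^{−x} ≤ 1`. -/
private theorem mul_exp_neg_le_one (x : ℝ) : x * Real.exp (-x) ≤ 1 := by
  rw [Real.exp_neg, ← div_eq_mul_inv, div_le_one (Real.exp_pos x)]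
  linarith [Real.add_one_le_exp x]

/-- The degree/height factor of the measure: for `1 ≤ n ≤ K` and `Y ≥ log 16`,
`n² Y (log Y + log n)² / (log Y)² ≤ K² (1 + K)² Y`. -/
theorem measure_factor_le {n K : ℕ} (hn1 : 1 ≤ n) (hnK : n ≤ K) {Y : ℝ} (hY : Real.log 16 ≤ Y) :
    (n : ℝ) ^ 2 * Y * (Real.log Y + Real.log n) ^ 2 / Real.log Y ^ 2 ≤
      (K : ℝ) ^ 2 * (1 + K) ^ 2 * Y := by
  have hlY : 1 < Real.log Y := one_lt_log_of_log_sixteen_le hY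
  have hY0 : 0 < Y := lt_of_lt_of_le (Real.log_pos (by norm_num)) hY
  have hn1r : (1 : ℝ) ≤ n := by exact_mod_cast hn1
  have hnKr : (n : ℝ) ≤ K := by exact_mod_cast hnK
  have hln0 : 0 ≤ Real.log n := Real.log_nonneg hn1r
  have hlnK : Real.log n ≤ K := (log_le_self_of_nonneg (by linarith)).trans hnKr
  rw [div_le_iff₀ (by positivity)]
  have h1 : Real.log Y + Real.log n ≤ (1 + K) * Real.log Y := by nlinarith
  have h2 : (Real.log Y + Real.log n) ^ 2 ≤ ((1 + K) * Real.log Y) ^ 2 :=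
    pow_le_pow_left₀ (by linarith) h1 2
  have h3 : (n : ℝ) ^ 2 ≤ (K : ℝ) ^ 2 := pow_le_pow_left₀ (by linarith) hnKr 2
  calc (n : ℝ) ^ 2 * Y * (Real.log Y + Real.log n) ^ 2
      ≤ (K : ℝ) ^ 2 * Y * ((1 + K) * Real.log Y) ^ 2 := by gcongr
    _ = (K : ℝ) ^ 2 * (1 + K) ^ 2 * Y * Real.log Y ^ 2 := by ring

/-- The constant `C₀(r)` grows at most quadratically in the denominator along approximations
of a fixed real `ρ`. -/
theorem C₀rat_le {ρ : ℝ} {r : ℚ} (hr : |ρ - r| ≤ 1) :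
    C₀rat r ≤ 1280000000 * (|ρ| + 4) * ((27 + 2 * |ρ|) * r.den) ^ 2 := by
  have hq1 : (1 : ℝ) ≤ r.den := by exact_mod_cast r.den_pos
  have hrρ : |(r : ℝ)| ≤ |ρ| + 1 := by
    have := abs_sub_abs_le_abs_sub (r : ℝ) ρ
    rw [abs_sub_comm] at this
    linarith
  have hceil : (⌈|(r : ℝ)|⌉₊ : ℝ) < |(r : ℝ)| + 1 := Nat.ceil_lt_add_one (abs_nonneg _)
  have hp : |(r.num : ℝ)| = |(r : ℝ)| * r.den := by
    have h : (r : ℝ) = r.num / r.den := Rat.cast_def r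
    have hq0 : (r.den : ℝ) ≠ 0 := by positivity
    have : (r.num : ℝ) = (r : ℝ) * r.den := by rw [h]; field_simp
    rw [this, abs_mul, Nat.abs_cast]
  have hmax : Real.log (max (|(r.num : ℝ)|) (r.den : ℝ)) ≤ (|ρ| + 2) * r.den := by
    have hm0 : 0 ≤ max (|(r.num : ℝ)|) (r.den : ℝ) := le_max_of_le_right (by linarith)
    refine (log_le_self_of_nonneg hm0).trans (max_le ?_ ?_)
    · rw [hp]; nlinarith
    · nlinarith [abs_nonneg ρ]
  unfold C₀rat
  have hA : (⌈|(r : ℝ)|⌉₊ : ℝ) + 2 ≤ |ρ| + 4 := by linarith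
  have hB : 1 + (20 + ((⌈|(r : ℝ)|⌉₊ : ℝ) + 2) + Real.log (max (|(r.num : ℝ)|) (r.den : ℝ))) ≤
      (27 + 2 * |ρ|) * r.den := by nlinarith [abs_nonneg ρ]
  have hB0 : 0 ≤ 1 + (20 + ((⌈|(r : ℝ)|⌉₊ : ℝ) + 2) + Real.log (max (|(r.num : ℝ)|) (r.den : ℝ))) := by
    have : 0 ≤ Real.log (max (|(r.num : ℝ)|) (r.den : ℝ)) :=
      Real.log_nonneg (le_max_of_le_right hq1)
    positivity
  have hC : 0 ≤ (⌈|(r : ℝ)|⌉₊ : ℝ) + 2 := by positivity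
  calc 1280000000 * ((⌈|(r : ℝ)|⌉₊ : ℝ) + 2) *
        (1 + (20 + ((⌈|(r : ℝ)|⌉₊ : ℝ) + 2) + Real.log (max (|(r.num : ℝ)|) (r.den : ℝ)))) ^ 2
      ≤ 1280000000 * (|ρ| + 4) * ((27 + 2 * |ρ|) * r.den) ^ 2 := by
        gcongr

end HyperCell

end Summit.Schanuel.Schanuel.Theorems.RootDecomp1KHyper
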